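import Mathlib

/-!
# Sketch — stub-ideation k4·g6 for `stub_cmLambdaLower`
(crux `ResidualThetaCountLowerPureAtTwo` = stmt-BirchSwinnertonDyer-26074; the stub is BY NAME the route item
RSL_g = `Theses.ResidualThetaTransportAtTwo.ResidualSignedLambdaLowerCMAtTwo` = stmt-BirchSwinnertonDyer-22608, OPEN).

Technique family 3 (assume the opposite · obstruction hunt · small cases).  This file holds the kernel-checked
by-products of the NEGATION CENSUS of `Ideas/stub-cmlambdalower-k4-g6.md`; it proves nothing about RSL_g,
(R≥)ᵖ or BSD and contains no `sorry`.

* §A  `IsLambdaPattern F d` — the currency of RSL_g's two `d`-hypotheses (every coefficient has norm `≤ ‖F_d‖`,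
      strictly `<` below `d`).  A1: the Kato-type factor `c₀ − c₁·(1+T)` with `‖c₀ − c₁‖ < ‖c₁‖` (e.g. `c₀ = c²`,
      `c₁ = c`, `c` odd, residue characteristic 2) has pattern index EXACTLY `1` — an integral Kato witness `_{c,d}z`
      forces decoration slack `normλ D ≥ 1` at `p = 2` (unit test T2 of Plan 1).  A2: a non-zero constant does not
      move the index (the `c` of `Col⁺(loc₂ z) = c·D·Lm`).  A3: the index is unique (so `d` in RSL_g is pinned by
      `Lm`).
* §B  decidable invariants the `p = 2` port uses silently (census C6/C7; Plan 3): B1 in `GL₂(𝔽₂)` an element of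
      order `3` fixes no non-zero vector (with the level-2 fundamental character of inertia at a supersingular `2`
      this is `A[ϖ]^{G_{ℚ_∞}} = 0`); B2 `¬ 3 ∣ 2^n` (the valuation-`1/3` argument for `Ŵ[2] ∩ Ŵ(ℚ_{2,n}) = 0`);
      B3 every local summand of RSL_g's exponent is EVEN once level primes carry `a_ℓ(g) = 0` (CM newforms are
      never Steinberg), so the smallest non-trivial instances are `(d, Σ) ∈ {(1,0), (0,2), (2,0)}`.
-/

set_option linter.dupNamespace false

namespace Summit.BirchSwinnertonDyer.BirchSwinnertonDyer.Cruxes.ResidualThetaCountLowerPureAtTwo.SideaK4G6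

open PowerSeries

section Pattern

variable {R : Type*} [NormedField R]

/-- The λ-pattern of RSL_g's `d`-hypotheses: `‖F_k‖ ≤ ‖F_d‖` for all `k` and `‖F_k‖ < ‖F_d‖` for `k < d`
(for integral coefficients with `F_d` a unit this says: Weierstrass degree / λ-invariant of `F` is `d`). -/
def IsLambdaPattern (F : R⟦X⟧) (d : ℕ) : Prop :=
  (∀ k, ‖coeff k F‖ ≤ ‖coeff d F‖) ∧ (∀ k < d, ‖coeff k F‖ < ‖coeff d F‖)

/-- A3 · the pattern index is unique. -/
theorem IsLambdaPattern.unique {F : R⟦X⟧} {d e : ℕ} (hd : IsLambdaPattern F d) (he : IsLambdaPattern F e) :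
    d = e := by
  rcases lt_trichotomy d e with h | h | h
  · exact absurd (hd.1 e) (not_le.mpr (he.2 d h))
  · exact h
  · exact absurd (he.1 d) (not_le.mpr (hd.2 e h))

/-- A2 · a non-zero constant does not move the pattern index (`Col⁺(loc₂ z) = c·D·Lm`: the `c` is λ-invisible). -/
theorem IsLambdaPattern.C_mul {F : R⟦X⟧} {d : ℕ} (hF : IsLambdaPattern F d) {c : R} (hc : c ≠ 0) :
    IsLambdaPattern (C c * F) d := by
  have hcpos : 0 < ‖c‖ := norm_pos_iff.mpr hc
  refine ⟨fun k ↦ ?_, fun k hk ↦ ?_⟩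
  · rw [coeff_C_mul, coeff_C_mul, norm_mul, norm_mul]
    exact mul_le_mul_of_nonneg_left (hF.1 k) hcpos.le
  · rw [coeff_C_mul, coeff_C_mul, norm_mul, norm_mul]
    exact mul_lt_mul_of_pos_left (hF.2 k hk) hcpos

/-- coefficient table of the Kato-type factor `c₀ − c₁·(1+T)`. -/
theorem coeff_katoFactor (c₀ c₁ : R) (k : ℕ) :
    coeff k (C c₀ - C c₁ * (1 + X) : R⟦X⟧) =
      if k = 0 then c₀ - c₁ else if k = 1 then -c₁ else 0 := by
  rw [map_sub, coeff_C_mul, map_add, coeff_C, coeff_one, coeff_X]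
  rcases k with _ | _ | k
  · simp
  · simp
  · simp

/-- A1 · **an integral Kato witness costs slack ≥ 1 at `p = 2`**: if `‖c₀ − c₁‖ < ‖c₁‖` (at residue characteristic `2`
this holds for `c₀ = c²`, `c₁ = c^e`, `c` odd, since `c² − c^e` is even), the factor `c₀ − c₁·(1+T)` has λ-pattern index
exactly `1` — never `0`.  (For `σ_c ↦ (1+T)^a` with `2 ∣ a` the index is `2^{v₂(a)}`; not needed here.) -/
theorem isLambdaPattern_katoFactor {c₀ c₁ : R} (h : ‖c₀ - c₁‖ < ‖c₁‖) :
    IsLambdaPattern (C c₀ - C c₁ * (1 + X) : R⟦X⟧) 1 := by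
  refine ⟨fun k ↦ ?_, fun k hk ↦ ?_⟩
  · rw [coeff_katoFactor, coeff_katoFactor]
    rcases k with _ | _ | k
    · simpa using h.le
    · simp
    · simp
  · obtain rfl : k = 0 := by omega
    rw [coeff_katoFactor, coeff_katoFactor]
    simpa using h

/-- A1′ · hence such a factor is never λ-invisible: pattern index `0` is impossible. -/
theorem not_isLambdaPattern_katoFactor_zero {c₀ c₁ : R} (h : ‖c₀ - c₁‖ < ‖c₁‖) :
    ¬ IsLambdaPattern (C c₀ - C c₁ * (1 + X) : R⟦X⟧) 0 := fun h0 ↦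
  absurd ((isLambdaPattern_katoFactor h).unique h0) one_ne_zero

end Pattern

section Decidable

/-- B1 · in `GL₂(𝔽₂) ≅ S₃` an element of order `3` has no non-zero fixed vector.  With inertia at a supersingular `2`
acting on `W[2]` through the level-2 fundamental character (order 3, odd, so surviving restriction to the pro-2
extension `ℚ_∞/ℚ`), this gives `W[2]^{G_{ℚ_∞}} = 0` and, after `⊗ 𝔽_q`, `A_g[ϖ]^{G_{ℚ_∞}} = 0` (census C6). -/
theorem order_three_fixes_nothing :
    ∀ A : Matrix (Fin 2) (Fin 2) (ZMod 2), A * A * A = 1 → A ≠ 1 →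
      ∀ v : Fin 2 → ZMod 2, A.mulVec v = v → v = 0 := by
  decide

/-- B1′ · and such elements exist (the image of tame inertia is non-trivial): `!![0,1;1,1]` has order `3`. -/
theorem exists_order_three : ∃ A : Matrix (Fin 2) (Fin 2) (ZMod 2), A * A * A = 1 ∧ A ≠ 1 :=
  ⟨!![0, 1; 1, 1], by decide, by decide⟩

/-- B2 · `3 ∤ 2^n`: a `2`-torsion point of the height-2 Honda formal group at a supersingular `2` with `a₂ = 0` has
valuation `v(x) = 1/3`, which is not in the value group `2^{-n}ℤ` of `ℚ_{2,n} = ℚ₂(μ_{2^{n+1}})`; so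
`Ŵ(ℚ_{2,n})[2] = 0` up the cyclotomic tower (census C7; Kato's `H²(ℚ_{∞,2}, T) = 0`). -/
theorem three_not_dvd_two_pow (n : ℕ) : ¬ 3 ∣ 2 ^ n := fun h ↦ by
  have := Nat.Prime.dvd_of_dvd_pow Nat.prime_three h
  omega

/-- B3 · the level-prime bracket of RSL_g's exponent vanishes once `a_ℓ(g) = 0` (`‖0 − 1‖ = 1 ≮ 1`). -/
theorem level_bracket_false {K : Type*} [NormedDivisionRing K] : ¬ ‖(0 : K) - 1‖ < 1 := by
  simp

/-- B3′ · hence every local summand `2^s · (if ℓ ∣ M then [‖a_ℓ − 1‖ < 1] else 2·[‖a_ℓ‖ < 1])` is even when the level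
branch is dead: the exponent `d + Σ` of RSL_g has `Σ` even, and the smallest non-trivial cases are
`(d, Σ) ∈ {(1,0), (0,2), (2,0)}` (Plan 3 regression ladder). -/
theorem localSummand_even (s : ℕ) (lvl P Q : Prop) [Decidable lvl] [Decidable P] [Decidable Q] (h : lvl → ¬ P) :
    Even (2 ^ s * (if lvl then (if P then 1 else 0) else (if Q then 2 else 0))) := by
  by_cases hl : lvl
  · have hP : ¬ P := h hl
    simp [hl, hP]
  · by_cases hQ : Q
    · simp only [hl, hQ, if_false, if_true]
      exact ⟨2 ^ s, by ring⟩
    · simp [hl, hQ]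

/-- B3″ · a finite sum of even local summands is even. -/
theorem sum_even_of_forall_even {ι : Type*} (s : Finset ι) (f : ι → ℕ) (h : ∀ i ∈ s, Even (f i)) :
    Even (∑ i ∈ s, f i) :=
  Finset.even_sum f h

end Decidable

end Summit.BirchSwinnertonDyer.BirchSwinnertonDyer.Cruxes.ResidualThetaCountLowerPureAtTwo.SideaK4G6
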